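import Literature.AlgebraicGeometry.HodgeTheory.WeilTypeAbelianVariety
import Summits.HodgeConjecture.HodgeConjecture.Theorems.Ring2TransportWeilTypeExactness
import HarnessLib

/-!
# Ring 2 · transport seat (gen 6) — JUNCTION of the Weil-type exactness theorem with the statement layer's `WeilType`

HONEST FRAMING (cell `pub-hodge-ring2`, verbatim): research route conditional on HC_CM; not a corollary;
Q11.4-sentence-2 already refuted in dim ≥ 3.

Seat `pub-hodge-ring2-transport` (gen 6; the statements of §1–§2 were staged by gen 4 on 2026-08-19T14:1xZ and could
not be checked until the farm built `Literature.AlgebraicGeometry.HodgeTheory.WeilTypeAbelianVariety`, operator ask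
W5, cleared 17:15Z). No `def`, no named fact, no `sorry`, no `HC_CM` declaration: `HC_CM` occurs only as the BINDER
`Theses.RankFourFaces.CMAbelianHodge` inside the item-16267 equivalence of §4; `HC_AV` is the tree item
`Theses.PadicSemiregularLift.HodgeAbelianVarieties` (stmt-HodgeConjecture-1333).

## What this file pins down

The exactness file `Theorems/Ring2TransportWeilTypeExactness.lean` (p188659) proved
`HC_AV ↔ HodgeWeilType` with the five Weil-type conjuncts written INLINE (`0 < n`, `0 < d`, `dim A = 2n`,
`φ ≫ φ = -d`, Weil plane of type `(n,n)`); the statement layer `Theorems/Ring2WeilTypeTargets.lean` (typer1, p191823)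
phrases the cell's class targets over the LANDED Literature structure `IsWeilType A φ n d` / `WeilType A`
(`Literature/AlgebraicGeometry/HodgeTheory/WeilTypeAbelianVariety.lean`, p184783) as local notations
`HC_WeilType[] := ∀ A, WeilType A → HodgeConjectureFor A.dim A.X`, `HC_WeilTypeAt[n, d] := ∀ A φ, IsWeilType A φ n d → …`,
`HC_AVDimLE[m]`, and proves the EASY arrows (`hc_weilType_of_hc_av : HC_AV → HC_WeilType[]`, …). This file supplies the
HARD arrows in exactly those words, through the tree's dictionary `isWeilType_iff_weilPlane`:

* §1 `isWeilType_splitSquare` / `weilType_splitSquare`: `(T × T, Φ_d)` IS of Weil type `(g, d)` in the statement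
  layer's sense for EVERY complex abelian variety `T` of dimension `g ≥ 1` and every `d ≥ 1` (all five fields are tree
  theorems: `dim_twistedSquare`, `splitSquare_comp_self`, `weilPlane_splitSquare`).
* §2 `hodgeWeilType_iff_isWeilType`, `hodgeWeilType_iff_weilType`, `hodgeWeilTypeColumn_iff_isWeilType`: the inline
  targets of the exactness file ARE the statement layer's targets.
* §3 EXACTNESS IN THE STATEMENT LAYER'S WORDS: `hodgeAbelianVarieties_iff_weilType : HC_AV ↔ HC_WeilType[]` (so the
  converse of typer1's `hc_weilType_of_hc_av` holds: `hodgeAbelianVarieties_of_weilType`); one column suffices,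
  `hodgeAbelianVarieties_iff_isWeilTypeColumn (0 < d) : HC_AV ↔ ∀ n, HC_WeilTypeAt[n, d]`; and the graded sandwich
  `hodgeConjectureFor_of_isWeilTypeAt_of_dim_le : HC_WeilTypeAt[n, d] → HC_AVDimLE[n]` /
  `isWeilTypeAt_of_forall_dim_eq : HC(all abelian 2n-folds) → HC_WeilTypeAt[n, d]` — e.g. the Hodge conjecture for the
  Weil-type abelian EIGHTFOLDS over one `ℚ(√-d)` already contains the Hodge conjecture for every abelian fourfold.
* §4 `cmToAbelian_iff_weilType_of_cmAbelianHodge : CMToAbelian ↔ (HC_CM → HC_WeilType[])` — the cell's headline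
  conditional target `HC_WeilType_of_HC_CM` is, granted nothing, the open route crux `CMToAbelian` (item
  stmt-HodgeConjecture-16267); typer1's `hc_weilType_of_cmToAbelian_of_hc_cm` is its `→` direction.

CONSEQUENCE for RING2-MAP (§transport (viii-a), §typer1, §LEAD L2.4): the statement layer's `HC_WeilType[]`,
every column `∀ n, HC_WeilTypeAt[n, d]` (`d ≥ 1`), and `HC_WeilType_of_HC_CM` are REFORMULATIONS of `HC_AV` resp.
of `CMToAbelian`, kernel-checked in typer1's own words; the meaningful Weil-type class targets remain the GENERAL
members (T6 / T6-CM / WΔ), the ladder rungs R1′–R3 (Weil classes only) and the fixed-`(n, d)` slices read through the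
sandwich `HC_AV(dim = 2n) ⟹ HC_WeilTypeAt[n, d] ⟹ HC_AV(dim ≤ n)`.

NOT CLAIMED (recorded in RING2-MAP §transport gen 6 as a remark, not a kernel statement): `(T × T, Φ_d)` with the
product polarization `E_T ⊕ d·E_T` is even of SPLIT Weil type (an `E_T`-Lagrangian `L ⊂ H₁(T, ℚ)` gives the
`Φ_d`-stable `E`-Lagrangian `L ⊕ L`, i.e. Witt index `g`; cf. Markman, arXiv:2502.03415 Lemma 3.1.3 for `X × X̂`),
so `HC_SplitWeilType[] ↔ HC_AV` as well; the tree's `IsSplitWeilType` asks for a hyperbolic `K`-symmetrised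
HYPERPLANE class of a projective embedding, whose cup-product bookkeeping on `H¹(T × T)` is not available on the
carriers for the mixing endomorphism `Φ_d` (the tree's `isHyperbolicWeilType_prod_of_rationalModels` treats `φ × ψ` only).

References: [vanGeemen1994HodgeAV] B. van Geemen, LNM 1594 (1994), 4.9–4.11, Lemma 5.2; [Deligne1982HodgeCycles]
P. Deligne (notes by J. Milne), Hodge cycles on abelian varieties, LNM 900 (1982), §4 Prop. 4.4, Lemma 4.5, Remark 4.10;
[Fulton1998] W. Fulton, Intersection Theory, §10.1 Example 10.1.2; [Markman2025SecantWeil] E. Markman, arXiv:2502.03415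
(UNREFEREED preprint), Lemma 3.1.3 — cited for the remark only. PerL / QW8 / the 2001 programme are cited nowhere.
-/

set_option linter.dupNamespace false

noncomputable section

open CategoryTheory

namespace Summit.HodgeConjecture.HodgeConjecture.Ring2Transport

open Literature.AlgebraicGeometry Literature.AlgebraicGeometry.Motives
open Literature.AlgebraicGeometry.HodgeTheory

/-! ## §1 Split squares are of Weil type in the statement layer's sense -/

section SplitSquare

variable {T : AbelianVariety ℂ} {g d : ℕ}

/-- The split square `(T × T, Φ_d)`, `Φ_d (x, y) = (-d·y, x)`, is of Weil type `(g, d)` in the sense of the Literature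
structure `IsWeilType` (van Geemen 4.9 on the carriers): all five fields are tree theorems (`dim_twistedSquare`,
`splitSquare_comp_self`, `weilPlane_splitSquare` through `isWeilType_iff_weilPlane`).
[cite: vanGeemen1994HodgeAV, 4.9] [cite: Deligne1982HodgeCycles, §4 Prop. 4.4 and Remark 4.10] -/
theorem isWeilType_splitSquare (hg : 0 < g) (hT : T.dim = g) (hd : 0 < d) :
    IsWeilType (T.prod T)
      (AbelianVariety.prodLift (AbelianVariety.snd T T ≫ (-(d • 𝟙 T))) (AbelianVariety.fst T T)) g d :=
  isWeilType_iff_weilPlane.mpr ⟨hg, hd, dim_twistedSquare hT, splitSquare_comp_self, weilPlane_splitSquare hg hT hd⟩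

/-- Every positive-dimensional complex abelian variety `T` is a factor of an abelian variety of Weil type, namely
`T × T` with `K = ℚ(i)` acting through `Φ₁`. [cite: Deligne1982HodgeCycles, §4 Remark 4.10] [cite: vanGeemen1994HodgeAV, 4.9] -/
theorem weilType_splitSquare (hT : 0 < T.dim) : WeilType (T.prod T) :=
  ⟨T.dim, 1, _, isWeilType_splitSquare hT rfl one_pos⟩

/-- … and through `Φ_d` for every `d ≥ 1` (every imaginary quadratic `ℚ(√-d)` occurs). [cite: vanGeemen1994HodgeAV, 4.9] -/
theorem weilType_splitSquare_of_pos (hT : 0 < T.dim) (hd : 0 < d) : WeilType (T.prod T) :=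
  ⟨T.dim, d, _, isWeilType_splitSquare hT rfl hd⟩

end SplitSquare

/-! ## §2 The inline targets of the exactness file ARE the statement layer's targets -/

/-- `HodgeWeilType` (five conjuncts inline) ⟺ "HC for every `IsWeilType` quadruple". [cite: vanGeemen1994HodgeAV, 4.9] -/
theorem hodgeWeilType_iff_isWeilType :
    HodgeWeilType ↔ ∀ (A : AbelianVariety ℂ) (φ : A ⟶ A) (n d : ℕ),
      IsWeilType A φ n d → HodgeConjectureFor A.dim A.X := by
  constructor
  · intro h A φ n d hW
    obtain ⟨h1, h2, h3, h4, h5⟩ := isWeilType_iff_weilPlane.mp hW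
    exact h A φ n d h1 h2 h3 h4 h5
  · intro h A φ n d h1 h2 h3 h4 h5
    exact h A φ n d (isWeilType_iff_weilPlane.mpr ⟨h1, h2, h3, h4, h5⟩)

/-- `HodgeWeilType` ⟺ `HC_WeilType[]` ("HC for every abelian variety of Weil type", `WeilType A := ∃ n d φ, IsWeilType A φ n d`).
[cite: vanGeemen1994HodgeAV, 4.9 and 4.13] -/
theorem hodgeWeilType_iff_weilType :
    HodgeWeilType ↔ ∀ A : AbelianVariety ℂ, WeilType A → HodgeConjectureFor A.dim A.X := by
  rw [hodgeWeilType_iff_isWeilType]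
  constructor
  · rintro h A ⟨n, d, φ, hW⟩
    exact h A φ n d hW
  · intro h A φ n d hW
    exact h A ⟨n, d, φ, hW⟩

/-- One column: `HodgeWeilTypeColumn d` ⟺ `∀ n, HC_WeilTypeAt[n, d]`. [cite: vanGeemen1994HodgeAV, 4.9 and 5.3] -/
theorem hodgeWeilTypeColumn_iff_isWeilType (d : ℕ) :
    HodgeWeilTypeColumn d ↔ ∀ (n : ℕ) (A : AbelianVariety ℂ) (φ : A ⟶ A),
      IsWeilType A φ n d → HodgeConjectureFor A.dim A.X := by
  constructor
  · intro h n A φ hW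
    obtain ⟨h1, h2, h3, h4, h5⟩ := isWeilType_iff_weilPlane.mp hW
    exact h A φ n h1 h2 h3 h4 h5
  · intro h A φ n h1 h2 h3 h4 h5
    exact h n A φ (isWeilType_iff_weilPlane.mpr ⟨h1, h2, h3, h4, h5⟩)

/-! ## §3 Exactness in the statement layer's words -/

/-- **`HC_AV ↔ HC_WeilType[]`**: the Hodge conjecture for every complex abelian variety of Weil type (all `K`
imaginary quadratic, all `n`, all discriminants, ALL members) is the Hodge conjecture for every complex abelian
variety. [cite: Deligne1982HodgeCycles, §4 Lemma 4.5 and Remark 4.10] [cite: vanGeemen1994HodgeAV, 4.9 and 4.11] -/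
theorem hodgeAbelianVarieties_iff_weilType :
    Theses.PadicSemiregularLift.HodgeAbelianVarieties ↔
      ∀ A : AbelianVariety ℂ, WeilType A → HodgeConjectureFor A.dim A.X :=
  hodgeAbelianVarieties_iff_hodgeWeilType.trans hodgeWeilType_iff_weilType

/-- The HARD arrow, converse of the statement layer's `hc_weilType_of_hc_av`: `HC_WeilType[] → HC_AV`
(apply the hypothesis to `T × T` with `Φ₁` and descend to the factor). [cite: Deligne1982HodgeCycles, §4 Lemma 4.5 and Remark 4.10]
[cite: Fulton1998, §10.1 Example 10.1.2] -/
theorem hodgeAbelianVarieties_of_weilType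
    (h : ∀ A : AbelianVariety ℂ, WeilType A → HodgeConjectureFor A.dim A.X) :
    Theses.PadicSemiregularLift.HodgeAbelianVarieties :=
  hodgeAbelianVarieties_iff_weilType.mpr h

/-- **One column is everything**: for every single `d ≥ 1`, `HC_AV ↔ ∀ n, HC_WeilTypeAt[n, d]`.
[cite: Deligne1982HodgeCycles, §4 Lemma 4.5 and Remark 4.10] [cite: vanGeemen1994HodgeAV, 4.9] -/
theorem hodgeAbelianVarieties_iff_isWeilTypeColumn {d : ℕ} (hd : 0 < d) :
    Theses.PadicSemiregularLift.HodgeAbelianVarieties ↔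
      ∀ (n : ℕ) (A : AbelianVariety ℂ) (φ : A ⟶ A), IsWeilType A φ n d → HodgeConjectureFor A.dim A.X :=
  (hodgeAbelianVarieties_iff_hodgeWeilTypeColumn hd).trans (hodgeWeilTypeColumn_iff_isWeilType d)

/-- **Sandwich, lower half**: the slice `HC_WeilTypeAt[n, d]` (`n, d ≥ 1`) gives the Hodge conjecture for EVERY complex
abelian variety of dimension `≤ n` (`HC_AVDimLE[n]`): apply it to `(T × T, Φ_d)` for `dim T = n` and descend; lower
dimensions by the tree's `forall_dim_le_of_forall_dim_eq`. E.g. `n = 4`: HC for the Weil-type abelian eightfolds over one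
`ℚ(√-d)` contains HC for every abelian fourfold. [cite: Deligne1982HodgeCycles, §4 Lemma 4.5 and Remark 4.10] [cite: Fulton1998, §10.1 Example 10.1.2] -/
theorem hodgeConjectureFor_of_isWeilTypeAt_of_dim_le {n d : ℕ} (hn : 0 < n) (hd : 0 < d)
    (h : ∀ (A : AbelianVariety ℂ) (φ : A ⟶ A), IsWeilType A φ n d → HodgeConjectureFor A.dim A.X) :
    ∀ T : AbelianVariety ℂ, T.dim ≤ n → HodgeConjectureFor T.dim T.X :=
  hodgeConjectureFor_of_weilSlice_of_dim_le hn hd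
    fun A φ hA hφ hW ↦ h A φ (isWeilType_iff_weilPlane.mpr ⟨hn, hd, hA, hφ, hW⟩)

/-- **Sandwich, upper half**: HC for all abelian `2n`-folds gives the slice `HC_WeilTypeAt[n, d]` for every `d`.
[cite: vanGeemen1994HodgeAV, 4.9] -/
theorem isWeilTypeAt_of_forall_dim_eq {n : ℕ}
    (h : ∀ A : AbelianVariety ℂ, A.dim = 2 * n → HodgeConjectureFor A.dim A.X) (d : ℕ) :
    ∀ (A : AbelianVariety ℂ) (φ : A ⟶ A), IsWeilType A φ n d → HodgeConjectureFor A.dim A.X :=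
  fun A _ hW ↦ h A hW.dim_eq

/-! ## §4 The conditional headline target in the statement layer's words is item 16267 -/

/-- **`CMToAbelian ↔ (HC_CM → HC_WeilType[])`**: granted nothing, "the Hodge conjecture for CM abelian varieties implies
the Hodge conjecture for every abelian variety of Weil type" is the open route crux `CMToAbelian`
(stmt-HodgeConjecture-16267) — `HC_CM` a binder, not an axiom. [cite: Deligne1982HodgeCycles, §4 Lemma 4.5 and Remark 4.10]
[cite: vanGeemen1994HodgeAV, 4.9 and 4.11] -/
theorem cmToAbelian_iff_weilType_of_cmAbelianHodge :
    Theses.RankFourFaces.CMToAbelian ↔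
      (Theses.RankFourFaces.CMAbelianHodge →
        ∀ A : AbelianVariety ℂ, WeilType A → HodgeConjectureFor A.dim A.X) := by
  rw [cmToAbelian_iff_hodgeWeilType_of_cmAbelianHodge, hodgeWeilType_iff_weilType]

/-- … and column-wise: `CMToAbelian ↔ (HC_CM → ∀ n, HC_WeilTypeAt[n, d])` for every `d ≥ 1`.
[cite: Deligne1982HodgeCycles, §4 Lemma 4.5 and Remark 4.10] -/
theorem cmToAbelian_iff_isWeilTypeColumn_of_cmAbelianHodge {d : ℕ} (hd : 0 < d) :
    Theses.RankFourFaces.CMToAbelian ↔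
      (Theses.RankFourFaces.CMAbelianHodge →
        ∀ (n : ℕ) (A : AbelianVariety ℂ) (φ : A ⟶ A), IsWeilType A φ n d → HodgeConjectureFor A.dim A.X) := by
  rw [cmToAbelian_iff_hodgeWeilTypeColumn_of_cmAbelianHodge hd, hodgeWeilTypeColumn_iff_isWeilType]

end Summit.HodgeConjecture.HodgeConjecture.Ring2Transport

end
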